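import Summits.HodgeConjecture.HodgeConjecture.Theorems.F0P3cStCharTSNoDecay
import HarnessLib

/-!
# F0 · P3c · line LH6 «StCharTS» — brick «EXP-ASYMP» of organ (S-a) (and of the shell road of (S-i)∕(S-ii)): ONE-SIDED ASYMPTOTICS OF A FINITE EXPONENTIAL
# SUM DETERMINE ITS LARGE-MODULUS COEFFICIENTS — `Σ_j b_j z_j^n = o(R^n)` (`n → +∞`) forces the coefficient sum over every fibre `{z_j = w}`, `‖w‖ ≥ R`, to vanish

Cell `pub/hodgecm-mathlib`, crux H413 = `stmt-HodgeConjecture-24833` (lane `--supports … --as helper`), route HCCMUnconditional; seat LH6-p05 (g0); organ (S-a)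
`stub_StSupportFiniteSqInt` of the LH6 pay-down skeleton (v2 3bd6ede806aaa044 :158) and the «shell» road of LH6-p02∕p04 (traces of `𝟙_{K aᵐ K}` are finite
exponential sums in `m`, ★ «CASS-SHELL» p848022).  THEOREMS ONLY, sorry-free; imports ★ «NODECAY» (p848279, this seat: the top-modulus step
`coeff_eq_zero_of_norm_le_norm`) and nothing else.
HONEST LABEL: HC_CM is proved only modulo the printed citations (2 remaining named inputs hLiu418 24832, h413 24833) until rung 0 closes; count-neutral algebra.

THE MATHEMATICS.  [Rogawski1990, §12.7 proof of Lemma 12.7.2, pp. 192–194]: the members `π` of the (β)-datum are separated by the GROWTH of their characters on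
the split torus `M` far from the walls — Casselman's theorem makes `D_G(γ)χ_π(γ)` a finite sum of exponentials `Σ c_{π,j} z_{π,j}^n` on the shells `‖α‖ = q^{−n}`,
square-integrable members have decaying exponents, principal-series members a non-decaying one, and «`|Σ z_j^n|` cannot converge to zero» (p. 194) ∕ «the sum
`Σ c_j z_j^m = 0` … for all `m` iff `c_j = 0`» (p. 193).  This file is the sharp common generalisation of ★ «VDM» (exact vanishing on a tail) and ★ «NODECAY»
(two-sided decay): a ONE-sided bound `o(R^n)` already kills every coefficient of modulus `≥ R`, fibre by fibre (no injectivity needed), and two exponential sums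
that agree up to `o(R^n)` on a tail have the same fibre sums at every `w` with `‖w‖ ≥ R`.

* `eq_zero_of_tendsto_sum_mul_pow_mul_inv_pow` — injective form: `(Σ_{i∈s} b_i z_i^n)·R^{−n} → 0`, `0 < R` ⇒ `b_i = 0` whenever `R ≤ ‖z_i‖`.
* `fiber_sum_eq_zero_of_tendsto_mul_inv_pow` — fibre form: same hypothesis ⇒ `Σ_{i∈s, z_i = w} b_i = 0` for every `‖w‖ ≥ R`.
* `fiber_sum_eq_zero_of_sum_mul_pow_eq_zero` — fibre-VDM: `Σ_{i∈s} b_i z_i^n = 0` for all `n ≥ m₀`, `z_i ≠ 0` ⇒ every fibre sum vanishes.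
* `fiber_sum_eq_fiber_sum_of_eq_on_tail` — UNIQUENESS: two finite exponential sums with non-zero bases agreeing for all `n ≥ m₀` have equal fibre sums everywhere.
* `fiber_sum_eq_fiber_sum_of_tendsto` — asymptotic uniqueness: agreement up to `o(R^n)` ⇒ equal fibre sums at every `‖w‖ ≥ R`.

## References
* [Rogawski1990] J. D. Rogawski, *Automorphic Representations of Unitary Groups in Three Variables*, Ann. of Math. Stud. 123 (1990), §12.7 proof of
  Lemma 12.7.2, pp. 192–194.
-/

set_option autoImplicit false
-- the mandated namespace has the single-problem summit's repeated segment (`HodgeConjecture.HodgeConjecture`)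
set_option linter.dupNamespace false

open Filter Topology
open scoped BigOperators

namespace Summit.HodgeConjecture.HodgeConjecture.Cruxes.H413.F0P3cStCharTSExpAsymp

open Summit.HodgeConjecture.HodgeConjecture.Cruxes.H413.F0P3cStCharTSNoDecay

/-! ## §1 One-sided decay at rate `R^n` kills the coefficients of modulus `≥ R` -/

/-- **Injective form.**  `z` injective on the finite set `s`, `0 < R`, and `(Σ_{i∈s} b_i z_i^n)·R^{−n} → 0` as `n → +∞` ⇒ `b_i = 0` for every `i ∈ s` with
`R ≤ ‖z_i‖` (rescale by `R` and apply the top-modulus step of «NODECAY» to the support of `b`: its element of largest modulus would have modulus `≥ R`).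
[cite: Rogawski1990, §12.7 proof of Lemma 12.7.2 pp. 193–194] -/
theorem eq_zero_of_tendsto_sum_mul_pow_mul_inv_pow {ι : Type*} (s : Finset ι) (z b : ι → ℂ) (hz : Set.InjOn z s) {R : ℝ} (hR : 0 < R)
    (h : Tendsto (fun n : ℕ => (∑ i ∈ s, b i * z i ^ n) * ((R : ℂ)⁻¹) ^ n) atTop (𝓝 0)) :
    ∀ i ∈ s, R ≤ ‖z i‖ → b i = 0 := by
  classical
  by_contra hcon
  push Not at hcon
  obtain ⟨i₀, hi₀, hRi₀, hbi₀⟩ := hcon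
  set s' : Finset ι := s.filter fun i => b i ≠ 0 with hs'
  have hsub : s' ⊆ s := Finset.filter_subset _ _
  have hi₀' : i₀ ∈ s' := Finset.mem_filter.2 ⟨hi₀, hbi₀⟩
  have hne : s'.Nonempty := ⟨i₀, hi₀'⟩
  have hR0 : (R : ℂ) ≠ 0 := by exact_mod_cast hR.ne'
  -- the rescaled family `z' i = z i / R`
  set z' : ι → ℂ := fun i => z i * ((R : ℂ)⁻¹) with hz'
  have hz'inj : Set.InjOn z' s' := fun i hi j hj hij =>
    hz (hsub hi) (hsub hj) (mul_right_cancel₀ (inv_ne_zero hR0) hij)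
  have hnorm : ∀ i, ‖z' i‖ = ‖z i‖ / R := fun i => by
    rw [hz', norm_mul, norm_inv, Complex.norm_real, Real.norm_of_nonneg hR.le, div_eq_mul_inv]
  obtain ⟨k, hk, hkmax⟩ := Finset.exists_max_image s' (fun i => ‖z' i‖) hne
  have h1 : 1 ≤ ‖z' k‖ := by
    refine le_trans ?_ (hkmax i₀ hi₀')
    rw [hnorm, le_div_iff₀ hR, one_mul]
    exact hRi₀
  have hsum : ∀ n : ℕ, (∑ i ∈ s, b i * z i ^ n) * ((R : ℂ)⁻¹) ^ n = ∑ i ∈ s', b i * z' i ^ n := fun n => by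
    have hfilt : ∑ i ∈ s', b i * z' i ^ n = ∑ i ∈ s, b i * z' i ^ n := by
      rw [hs']
      exact Finset.sum_filter_of_ne fun i _ hne' hb0 => hne' (by rw [hb0, zero_mul])
    rw [hfilt, Finset.sum_mul]
    refine Finset.sum_congr rfl fun i _ => ?_
    show b i * z i ^ n * ((R : ℂ)⁻¹) ^ n = b i * (z i * ((R : ℂ)⁻¹)) ^ n
    rw [mul_pow, mul_assoc]
  have h' : Tendsto (fun n : ℕ => ∑ i ∈ s', b i * z' i ^ n) atTop (𝓝 0) := h.congr hsum
  have hbk := coeff_eq_zero_of_norm_le_norm s' z' b hz'inj h' hk hkmax h1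
  exact (Finset.mem_filter.1 hk).2 hbk

/-- **Fibre form (no injectivity).**  `0 < R` and `(Σ_{i∈s} b_i z_i^n)·R^{−n} → 0` as `n → +∞` ⇒ for every `w` with `R ≤ ‖w‖` the coefficient sum over the
fibre vanishes: `Σ_{i∈s, z_i = w} b_i = 0` (group the terms by the value of `z`). [cite: Rogawski1990, §12.7 proof of Lemma 12.7.2 pp. 193–194] -/
theorem fiber_sum_eq_zero_of_tendsto_mul_inv_pow {ι : Type*} (s : Finset ι) (z b : ι → ℂ) {R : ℝ} (hR : 0 < R)
    (h : Tendsto (fun n : ℕ => (∑ i ∈ s, b i * z i ^ n) * ((R : ℂ)⁻¹) ^ n) atTop (𝓝 0)) (w : ℂ) (hw : R ≤ ‖w‖) :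
    ∑ i ∈ s with z i = w, b i = 0 := by
  classical
  set c : ℂ → ℂ := fun w => ∑ i ∈ s with z i = w, b i with hc
  have hgroup : ∀ n : ℕ, ∑ i ∈ s, b i * z i ^ n = ∑ w ∈ s.image z, c w * w ^ n := fun n => by
    rw [← Finset.sum_fiberwise_of_maps_to (g := z) (t := s.image z) fun i hi => Finset.mem_image_of_mem z hi]
    refine Finset.sum_congr rfl fun w _ => ?_
    rw [hc, Finset.sum_mul]
    refine Finset.sum_congr rfl fun i hi => ?_
    rw [(Finset.mem_filter.1 hi).2]
  have h' : Tendsto (fun n : ℕ => (∑ w ∈ s.image z, c w * w ^ n) * ((R : ℂ)⁻¹) ^ n) atTop (𝓝 0) :=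
    h.congr fun n => by rw [hgroup n]
  have hmain := eq_zero_of_tendsto_sum_mul_pow_mul_inv_pow (s.image z) id c (Set.injOn_id _) hR h'
  by_cases hmem : w ∈ s.image z
  · exact hmain w hmem hw
  · refine Finset.sum_eq_zero fun i hi => ?_
    exact absurd (Finset.mem_image.2 ⟨i, (Finset.mem_filter.1 hi).1, (Finset.mem_filter.1 hi).2⟩) hmem

/-! ## §2 Exact vanishing ∕ agreement on a tail (fibre-VDM and uniqueness of exponential sums) -/

/-- **Fibre-VDM.**  `z_i ≠ 0` on `s` and `Σ_{i∈s} b_i z_i^n = 0` for every `n ≥ m₀` ⇒ every fibre sum `Σ_{i∈s, z_i = w} b_i` vanishes (for `w ≠ 0` apply §1 with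
`R = ‖w‖` to an eventually-zero sequence; the fibre over `0` is empty).  ★ «VDM» `F0P3cStCharTSVandermonde.eq_zero_of_sum_mul_pow_eq_zero` is the injective case.
[cite: Rogawski1990, §12.7 proof of Lemma 12.7.2 p. 193] -/
theorem fiber_sum_eq_zero_of_sum_mul_pow_eq_zero {ι : Type*} (s : Finset ι) (z b : ι → ℂ) (hz0 : ∀ i ∈ s, z i ≠ 0) (m₀ : ℕ)
    (h : ∀ n : ℕ, m₀ ≤ n → ∑ i ∈ s, b i * z i ^ n = 0) (w : ℂ) : ∑ i ∈ s with z i = w, b i = 0 := by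
  classical
  by_cases hw : w = 0
  · refine Finset.sum_eq_zero fun i hi => ?_
    exact absurd ((Finset.mem_filter.1 hi).2.trans hw) (hz0 i (Finset.mem_filter.1 hi).1)
  · have hR : 0 < ‖w‖ := norm_pos_iff.2 hw
    refine fiber_sum_eq_zero_of_tendsto_mul_inv_pow s z b hR ?_ w le_rfl
    refine tendsto_const_nhds.congr' ?_
    rw [EventuallyEq, eventually_atTop]
    exact ⟨m₀, fun n hn => by rw [h n hn, zero_mul]⟩

/-- **Uniqueness of finite exponential sums.**  Two finite exponential sums with NON-ZERO bases that agree for all `n ≥ m₀`,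
`Σ_{i∈s} b_i z_i^n = Σ_{j∈t} c_j w_j^n`, have the same coefficient sum over every fibre: `Σ_{i∈s, z_i = v} b_i = Σ_{j∈t, w_j = v} c_j` for every `v`
(apply the fibre-VDM to the difference, indexed by `ι ⊕ κ`). [cite: Rogawski1990, §12.7 proof of Lemma 12.7.2 p. 193] -/
theorem fiber_sum_eq_fiber_sum_of_eq_on_tail {ι κ : Type*} (s : Finset ι) (z b : ι → ℂ) (t : Finset κ) (w c : κ → ℂ)
    (hz0 : ∀ i ∈ s, z i ≠ 0) (hw0 : ∀ j ∈ t, w j ≠ 0) (m₀ : ℕ)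
    (h : ∀ n : ℕ, m₀ ≤ n → ∑ i ∈ s, b i * z i ^ n = ∑ j ∈ t, c j * w j ^ n) (v : ℂ) :
    ∑ i ∈ s with z i = v, b i = ∑ j ∈ t with w j = v, c j := by
  classical
  -- the difference family on `ι ⊕ κ`
  have hdiff := fiber_sum_eq_zero_of_sum_mul_pow_eq_zero (s.disjSum t) (Sum.elim z w) (Sum.elim b (fun j => - c j))
    (fun x hx => by
      rcases Finset.mem_disjSum.1 hx with ⟨i, hi, rfl⟩ | ⟨j, hj, rfl⟩
      · exact hz0 i hi
      · exact hw0 j hj) m₀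
    (fun n hn => by
      rw [Finset.sum_disjSum]
      simp only [Sum.elim_inl, Sum.elim_inr, neg_mul, Finset.sum_neg_distrib]
      rw [h n hn, add_neg_cancel]) v
  rw [Finset.sum_filter, Finset.sum_disjSum] at hdiff
  simp only [Sum.elim_inl, Sum.elim_inr] at hdiff
  rw [← Finset.sum_filter, ← Finset.sum_filter, Finset.sum_neg_distrib] at hdiff
  exact (sub_eq_zero.1 (by rw [sub_eq_add_neg]; exact hdiff))

/-- **Asymptotic uniqueness.**  Two finite exponential sums that agree up to `o(R^n)` as `n → +∞` (`0 < R`),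
`((Σ_{i∈s} b_i z_i^n) − (Σ_{j∈t} c_j w_j^n))·R^{−n} → 0`, have the same coefficient sum over every fibre of modulus `≥ R`.
[cite: Rogawski1990, §12.7 proof of Lemma 12.7.2 pp. 193–194] -/
theorem fiber_sum_eq_fiber_sum_of_tendsto {ι κ : Type*} (s : Finset ι) (z b : ι → ℂ) (t : Finset κ) (w c : κ → ℂ) {R : ℝ} (hR : 0 < R)
    (h : Tendsto (fun n : ℕ => ((∑ i ∈ s, b i * z i ^ n) - ∑ j ∈ t, c j * w j ^ n) * ((R : ℂ)⁻¹) ^ n) atTop (𝓝 0))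
    (v : ℂ) (hv : R ≤ ‖v‖) :
    ∑ i ∈ s with z i = v, b i = ∑ j ∈ t with w j = v, c j := by
  classical
  have hdiff := fiber_sum_eq_zero_of_tendsto_mul_inv_pow (s.disjSum t) (Sum.elim z w) (Sum.elim b (fun j => - c j)) hR
    (h.congr fun n => by
      rw [Finset.sum_disjSum]
      simp only [Sum.elim_inl, Sum.elim_inr, neg_mul, Finset.sum_neg_distrib]
      rw [sub_eq_add_neg]) v hv
  rw [Finset.sum_filter, Finset.sum_disjSum] at hdiff
  simp only [Sum.elim_inl, Sum.elim_inr] at hdiff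
  rw [← Finset.sum_filter, ← Finset.sum_filter, Finset.sum_neg_distrib] at hdiff
  exact (sub_eq_zero.1 (by rw [sub_eq_add_neg]; exact hdiff))

end Summit.HodgeConjecture.HodgeConjecture.Cruxes.H413.F0P3cStCharTSExpAsymp
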